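import Summits.FinalStateConjecture.FinalStateConjecture.Theses.LaminatedThreshold
import Literature.Geometry.Lorentzian.VisibleIncompleteNullRay
import Literature.Geometry.Lorentzian.LeviCivitaProofs

/-!
# Crux `LaminatedThreshold` · line `SketchIdeator1` (caged comb) · stub `stub_nakedNotSettled` — DIAGNOSIS

Stub-worker diagnosis file (line lead's worker) (2026-08-17). The registered stub `stub_nakedNotSettled` (text
`refs/h3_nakedNotSettled.sig` = `NakedNotSettled` of `Cruxes/LaminatedThreshold/Lines/birth.lean`) is
NOT proved here: it is a universal statement of large-data general relativity over every maximal vacuum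
Cauchy development of every admissible datum, and neither of its two proof avenues is available from the
typed clauses by the tree's (soft) causal library. This file kernel-checks the two reductions that
locate the missing content exactly (both hypotheses are spelled out over existing tree notions only):

* `stub_of_visibleIncompleteCutsScri` — avenue (A): IF "a visible future-incomplete null ray of an MGHD
  of admissible data forces incomplete sojourn-`𝓘⁺`" (Hawking–Ellis Prop. 9.2.1 read intrinsically),
  THEN the stub, in three lines. The hypothesis is FALSE at the level of abstract Cauchy developments
  (non-vacuum, non-maximal: the conformal blow-up model of the evidence note), so any proof of it must use
  `Ric = 0` and maximality — the Cauchy-horizon analysis of the MGHD boundary; not in the tree, not a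
  published theorem in this intrinsic generality.
* `stub_of_settledClosureNullComplete` — avenue (B): IF "in an MGHD of admissible data with complete
  sojourn-`𝓘⁺` and a sub-extremal, ray-closed, exhaustive, future-oriented Kerr decomposition of
  `O = exteriorOf 𝒟 d.charted`, every maximal future-directed null geodesic whose events from parameter
  `0` on lie in `I⁻(closure O)` is future complete", THEN the stub: a visible ray's events lie in
  `I⁻(δ'(s ∩ [0,∞)))` for complete normalised rays `δ'`, and `RaysStayInClosure` puts those images in
  `closure O` (`chronologicalPast_mono`). The hypothesis needs a RATE of `C²`-convergence integrable in
  chart time (Grönwall on the blueshift factor), which `FinalStateDecomposition.tendsto_truncDeviationCk`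
  / `HasExhaustiveCharts` do not carry; for vacuum it is plausible but unproved (large data).

Landed as a `--supports` file of the crux item (registered support statements `stub_of_visibleIncompleteCutsScri`,
`stub_of_settledClosureNullComplete`), so that the two missing lemmas are on record in the tree.
-/

noncomputable section

-- the doubled `FinalStateConjecture.FinalStateConjecture` path component trips dupNamespace
set_option linter.dupNamespace false

namespace Summit.FinalStateConjecture.FinalStateConjecture.Theorems.LaminatedThreshold.NakedNotSettledDiagnosis

open Set Filter Function Topology TopologicalSpace
open scoped Manifold ContDiff
open Literature.Geometry.Lorentzian

/-- **The stub from avenue (A)** (three lines: the first conjunct of "settled" is complete `𝓘⁺`).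
[cite: HawkingEllis1973CUP, §9.2, Prop. 9.2.1] -/
theorem stub_of_visibleIncompleteCutsScri :
    (∀ (X : Type) [TopologicalSpace X] [ChartedSpace E3 X] [IsManifold (𝓡 3) ∞ X] [T2Space X]
    [SecondCountableTopology X] [ConnectedSpace X],
    ∀ D ∈ admissibleVacuumData X, ∀ 𝒟 : VacuumCauchyDevelopment D, 𝒟.IsMaximal →
      ∀ [𝒟.metric.HasLeviCivita] (γ : ℝ → 𝒟.carrier) (dom : Set ℝ),
        𝒟.toDataEmbedding.IsVisibleIncompleteNullRay γ dom →
          ¬ 𝒟.metric.HasCompleteFutureNullInfinity 𝒟.timeOrientation 𝒟.embed 𝒟.normal) →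
    ∀ (X : Type) [TopologicalSpace X] [ChartedSpace Literature.Geometry.Lorentzian.E3 X] [IsManifold (𝓡 3) ((⊤ : ℕ∞) : WithTop ℕ∞) X] [T2Space X] [SecondCountableTopology X] [ConnectedSpace X], ∀ D ∈ Literature.Geometry.Lorentzian.admissibleVacuumData X, ∀ 𝒟 : Literature.Geometry.Lorentzian.VacuumCauchyDevelopment D, 𝒟.IsMaximal → (∀ [𝒟.metric.HasLeviCivita], ∃ (γ : ℝ → 𝒟.carrier) (dom : Set ℝ), (Literature.Geometry.Lorentzian.IsMaximalGeodesicOn 𝒟.metric.leviCivita γ dom ∧ (0 : ℝ) ∈ dom ∧ BddAbove dom ∧ (∀ t ∈ dom, 𝒟.metric.IsNull (Literature.Geometry.Lorentzian.velocity (𝓡 4) γ t) ∧ 𝒟.timeOrientation.IsFutureDirected (Literature.Geometry.Lorentzian.velocity (𝓡 4) γ t)) ∧ (∀ t ∈ dom, 0 ≤ t → (∃ (p : X) (δ' : ℝ → 𝒟.carrier) (s : Set ℝ), 𝒟.metric.IsNormalisedNullRayFrom 𝒟.timeOrientation 𝒟.embed 𝒟.normal p δ' s ∧ ¬ BddAbove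 s ∧ γ t ∈ 𝒟.metric.chronologicalPast 𝒟.timeOrientation (δ' '' (s ∩ Set.Ici 0)))))) → ¬ (Summit.FinalStateConjecture.HasCompleteNullInfinity 𝒟.toCauchyDevelopment ∧ ∃ (O : Set 𝒟.carrier) (d : Literature.Geometry.Lorentzian.FinalStateDecomposition 𝒟.toSpacetime O 2), (∀ i, Literature.Geometry.Lorentzian.Kerr.IsSubextremal (d.mass i) (d.spin i)) ∧ O = Summit.FinalStateConjecture.exteriorOf 𝒟.toCauchyDevelopment d.charted ∧ Summit.FinalStateConjecture.RaysStayInClosure 𝒟.toCauchyDevelopment O ∧ Summit.FinalStateConjecture.HasExhaustiveCharts d ∧ Summit.FinalStateConjecture.IsFutureOriented d) := by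
  intro hA X _ _ _ _ _ _ D hD 𝒟 hmax hnaked
  rintro ⟨hscri, -⟩
  haveI : 𝒟.metric.toPseudoRiemannianMetric.HasLeviCivita := 𝒟.metric.toPseudoRiemannianMetric.hasLeviCivita
  obtain ⟨γ, dom, hγ⟩ := hnaked
  exact hA X D hD 𝒟 hmax γ dom hγ hscri

/-- **The stub from avenue (B)**: the visible incomplete ray `γ` has its events `γ t`, `t ≥ 0`, in
`I⁻(δ'(s ∩ [0, ∞)))` for future-complete normalised rays `δ'`, whose images lie in `closure O` by
`RaysStayInClosure`; so `γ` runs in `I⁻(closure O)` and avenue (B) makes it future complete, against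
`BddAbove dom`. [cite: DafermosLuk2017, Conjecture 1] -/
theorem stub_of_settledClosureNullComplete :
    (∀ (X : Type) [TopologicalSpace X] [ChartedSpace E3 X] [IsManifold (𝓡 3) ∞ X] [T2Space X]
    [SecondCountableTopology X] [ConnectedSpace X],
    ∀ D ∈ admissibleVacuumData X, ∀ 𝒟 : VacuumCauchyDevelopment D, 𝒟.IsMaximal →
      ∀ [𝒟.metric.HasLeviCivita] (O : Set 𝒟.carrier) (d : FinalStateDecomposition 𝒟.toSpacetime O 2),
        (∀ i, Kerr.IsSubextremal (d.mass i) (d.spin i)) →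
        O = Summit.FinalStateConjecture.exteriorOf 𝒟.toCauchyDevelopment d.charted →
        Summit.FinalStateConjecture.RaysStayInClosure 𝒟.toCauchyDevelopment O →
        Summit.FinalStateConjecture.HasExhaustiveCharts d →
        Summit.FinalStateConjecture.IsFutureOriented d →
        Summit.FinalStateConjecture.HasCompleteNullInfinity 𝒟.toCauchyDevelopment →
        ∀ (γ : ℝ → 𝒟.carrier) (dom : Set ℝ), IsMaximalGeodesicOn 𝒟.metric.leviCivita γ dom →
          (0 : ℝ) ∈ dom →
          (∀ t ∈ dom, 𝒟.metric.IsNull (velocity (𝓡 4) γ t) ∧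
            𝒟.timeOrientation.IsFutureDirected (velocity (𝓡 4) γ t)) →
          (∀ t ∈ dom, 0 ≤ t →
            γ t ∈ 𝒟.metric.chronologicalPast 𝒟.timeOrientation (closure O)) →
          ¬ BddAbove dom) →
    ∀ (X : Type) [TopologicalSpace X] [ChartedSpace Literature.Geometry.Lorentzian.E3 X] [IsManifold (𝓡 3) ((⊤ : ℕ∞) : WithTop ℕ∞) X] [T2Space X] [SecondCountableTopology X] [ConnectedSpace X], ∀ D ∈ Literature.Geometry.Lorentzian.admissibleVacuumData X, ∀ 𝒟 : Literature.Geometry.Lorentzian.VacuumCauchyDevelopment D, 𝒟.IsMaximal → (∀ [𝒟.metric.HasLeviCivita], ∃ (γ : ℝ → 𝒟.carrier) (dom : Set ℝ), (Literature.Geometry.Lorentzian.IsMaximalGeodesicOn 𝒟.metric.leviCivita γ dom ∧ (0 : ℝ) ∈ dom ∧ BddAbove dom ∧ (∀ t ∈ dom, 𝒟.metric.IsNull (Literature.Geometry.Lorentzian.velocity (𝓡 4) γ t) ∧ 𝒟.timeOrientation.IsFutureDirected (Literature.Geometry.Lorentzian.velocity (𝓡 4) γ t)) ∧ (∀ t ∈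 dom, 0 ≤ t → (∃ (p : X) (δ' : ℝ → 𝒟.carrier) (s : Set ℝ), 𝒟.metric.IsNormalisedNullRayFrom 𝒟.timeOrientation 𝒟.embed 𝒟.normal p δ' s ∧ ¬ BddAbove s ∧ γ t ∈ 𝒟.metric.chronologicalPast 𝒟.timeOrientation (δ' '' (s ∩ Set.Ici 0)))))) → ¬ (Summit.FinalStateConjecture.HasCompleteNullInfinity 𝒟.toCauchyDevelopment ∧ ∃ (O : Set 𝒟.carrier) (d : Literature.Geometry.Lorentzian.FinalStateDecomposition 𝒟.toSpacetime O 2), (∀ i, Literature.Geometry.Lorentzian.Kerr.IsSubextremal (d.mass i) (d.spin i)) ∧ O = Summit.FinalStateConjecture.exteriorOf 𝒟.toCauchyDevelopment d.charted ∧ Summit.FinalStateConjecture.RaysStayInClosure 𝒟.toCauchyDevelopment O ∧ Summit.FinalStateConjecture.HasExhaustiveCharts d ∧ Summit.FinalStateConjecture.IsFutureOriented d) := by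
  intro hB X _ _ _ _ _ _ D hD 𝒟 hmax hnaked
  rintro ⟨hscri, O, d, hsub, hO, hrays, hexh, hfo⟩
  haveI : 𝒟.metric.toPseudoRiemannianMetric.HasLeviCivita := 𝒟.metric.toPseudoRiemannianMetric.hasLeviCivita
  obtain ⟨γ, dom, hgeo, h0, hbdd, hnull, hvis⟩ := hnaked
  refine hB X D hD 𝒟 hmax O d hsub hO hrays hexh hfo hscri γ dom hgeo h0 hnull ?_ hbdd
  intro t ht ht0
  obtain ⟨p, δ', s, hδ', hs, hγt⟩ := hvis t ht ht0
  refine LorentzianMetric.chronologicalPast_mono ?_ hγt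
  rintro _ ⟨t', ⟨ht', ht'0⟩, rfl⟩
  exact hrays p δ' s hδ' hs t' ht' ht'0

/-- **Why avenue (A) is not a definition chase**: the sojourn form of complete `𝓘⁺` is insensitive to
the normalised rays issuing from any fixed compact piece of the data — if all normalised rays from
outside ONE compact `B₁ ⊆ X` are future complete, `𝓘⁺` is complete (take `B₀ = ∅` and the same `B₁`
for every `s`). So a single incomplete (visible or not) null geodesic, which crosses `ι(X)` at most at
points of a compact set, is formally compatible with `HasCompleteFutureNullInfinity`; the content of
(A) is that nakedness PROPAGATES incompleteness to rays from arbitrarily far out (Cauchy horizon).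
Christodoulou, CQG 16 (1999) A23, p. A27. [cite: Christodoulou1999, p. A27] -/
theorem hasCompleteFutureNullInfinity_of_complete_outside_compact
    {E : Type*} [NormedAddCommGroup E] [NormedSpace ℝ E] {H : Type*} [TopologicalSpace H]
    {I : ModelWithCorners ℝ E H} {M : Type*} [TopologicalSpace M] [ChartedSpace H M]
    [IsManifold I ∞ M] {X : Type*} [TopologicalSpace X] {g : LorentzianMetric I ∞ M}
    {τ : TimeOrientation g} {ι : X → M} [FiniteDimensional ℝ E] [g.HasLeviCivita]
    {N : NormalField I ι} {B₁ : Set X} (hB₁ : IsCompact B₁)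
    (h : ∀ p ∉ B₁, ∀ (γ : ℝ → M) (dom : Set ℝ), g.IsNormalisedNullRayFrom τ ι N p γ dom →
      ¬ BddAbove dom) :
    g.HasCompleteFutureNullInfinity τ ι N :=
  ⟨∅, isCompact_empty, fun _ _ ↦ ⟨B₁, hB₁, fun p hp γ dom hγ ↦ Or.inl (h p hp γ dom hγ)⟩⟩

end Summit.FinalStateConjecture.FinalStateConjecture.Theorems.LaminatedThreshold.NakedNotSettledDiagnosis

end
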